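import Mathlib
import HarnessLib

/-!
# Ventures/CertifiedQuantumChemistry — Rows/SweepContraction.lean: the left-to-right MPS × MPO × MPS transfer
# recursion computes the configuration sum EXACTLY (the identity of FORMAT-qcmps0 §4, line 1, behind every
# `qc-upper-v0` MPS certificate)

HONEST FRAMING (verbatim): certified bounds for a stated model Hamiltonian in a stated basis; not a
claim about the real molecule beyond that model.

var-2 (gen 6), zero compute, PROVED glue only (0 sorry, no definition, no claim node, no bound asserted about any
model); intended first instance: the MPS upper certificates of rows #114 / #127 / #130 and the R2B-U / R3A-U rows
(FORMAT-qcmps0 §4 / §4c / §4d / §4e), whose VALUE is obtained by the environment recursion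

  `L_0 = boundary`,  `M[x,s′] = L_b[x]·A_b^{s′}`,  `N[y,s] = Σ_{x,s,s′} O_b[x,y][s,s′]·M[x,s′]`,
  `L_{b+1}[y] = Σ_s (A_b^{s})ᵀ·N[y,s]`,                                   (FORMAT-qcmps0 §4, "Recursion")

one block `L_b[x]` per MPO bond state `x`, and then reading `⟨ψ|H|ψ⟩ = L_k[END]`. This file is the finite-sum
identity that justifies that reading, in exact arithmetic over any commutative ring (the certificates' floating
point / interval EVALUATIONS of the same recursion are controlled by `Rows/SweepErrorBudget.lean`):

* `transferStep_three_stage_eq` — the three-stage form above equals the one-line form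
  `L_{b+1}[y] = Σ_x Σ_s Σ_{s′} O_b[x,y][s,s′] • (A_b^s)ᵀ L_b[x] B_b^{s′}` (bra tensor `A`, ket tensor `B`);
* **`sweep_eq_sum_ofFn_prod`** — for ANY families of bra / ket site tensors `A b s, B b s` (square blocks over one
  bond index type `n`; the cell's block-sparse rectangular blocks are the zero-padded instance), MPO site tensors
  `O b s s′` (matrices over one MPO bond index type `m`; entry `(O b s s′) x y = O_b[x,y][s,s′]`) and ANY initial
  environment `L 0`, the `k`-th environment is the sum over bra / ket configurations `s, s′ : Fin k → σ` of
  `(O_0[s₀,s′₀] ⋯ O_{k-1}[s_{k-1},s′_{k-1}])[x,y] •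
      (A_0^{s₀} ⋯ A_{k-1}^{s_{k-1}})ᵀ · L_0[x] · (B_0^{s′₀} ⋯ B_{k-1}^{s′_{k-1}})`,
  i.e. the MPO word product (automaton paths from `x` to `y`) times the transposed bra word, the boundary block and
  the ket word — proved by induction on `k`, peeling the last site (`List.ofFn_succ'`, `Fin.snocEquiv`);
* `dotProduct_sweep_mulVec_eq` — closing with boundary vectors: if `L 0 x = [x = x₀] · u u′ᵀ` then
  `w ⬝ (L k y) w′ = Σ_{s,s′} (O-word)[x₀,y] · ψ_A(s) · ψ_B(s′)` with the open-boundary amplitudes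
  `ψ_A(s) = u ⬝ (A-word s) w`, `ψ_B(s′) = u′ ⬝ (B-word s′) w′` — the bilinear form `⟨ψ_A| O |ψ_B⟩` of the operator
  whose configuration matrix elements are the MPO word products (for the cell's files `D_0 = D_k = 1`, so after
  padding `u = w = u′ = w′ = e₀`, `x₀ = START`, `y = END`, `A = B` = the state's blocks: `⟨ψ|H_F|ψ⟩ = L_k[END]`);
* `gram_sweep_eq_sum_ofFn_prod`, `dotProduct_gram_sweep_mulVec_eq` — the same for the "trivial MPO" recursion
  `G_{b+1} = Σ_s (A_b^s)ᵀ G_b B_b^s` giving `⟨ψ_A|ψ_B⟩ = Σ_s ψ_A(s) ψ_B(s)` (the `⟨ψ|ψ⟩` sweep of §4).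
* `sum_rev_words_eq` (gen 6 append, section `Reverse`) — CHAIN REVERSAL: the mirrored problem of `reverse_problem`
  (sites reversed, tensors transposed, `O′_i[y,x][s,s′] = O_{k-1-i}[x,y][s′,s]`, boundary data exchanged) has the
  same configuration sum with bra and ket exchanged — for one state literally the same number.
* `le_mul_of_enclosure` / `le_max_div_mul_of_enclosure` (gen 6 append, section `ValueRule`) — the VALUE RULE of the
  certificate (FORMAT-qcu0 §3 / FORMAT-qcmps0 §4 BOUND): enclosures `⟨ψ|Hψ⟩ ≤ hhi`, `0 < nlo ≤ ⟨ψ|ψ⟩ ≤ nhi` and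
  `E ≥ (hhi/nlo if 0 ≤ hhi else hhi/nhi)` give `⟨ψ|Hψ⟩ ≤ E · ⟨ψ|ψ⟩` — the `UpperCertificate` inequality, per lineage.

The right-to-left sweep of the code (`reverse_problem`: `A′ˢ = (Aˢ)ᵀ`, `O′[y,x][s,s′] = O[x,y][s′,s]`, sites in
reverse order) is the same recursion on mirrored families, hence an instance of the same theorem. Which operator the
MPO words represent (`Σ_paths = H_F` for the exact QC-MPO of §3) is instance data checked outside the kernel, exactly
as for every certificate of the cell. Relation to the tree: `Literature/…/QuantumLattice/OpenMPSProductExpectation`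
is the uniform-tensor, PRODUCT-operator (`m = Unit`) special case over `ℂ`; here tensors are site dependent and the
operator is a general MPO, as the certificates need. References: U. Schollwöck, Ann. Phys. 326 (2011) 96, §4.2.1 /
§6.2 (iterative evaluation of MPO expectation values by left/right environments); FORMAT-qcmps0 §4 (HOME
`pub-qchem-var2/FORMAT-qcmps0.md`); qcmps `contract*.py`.
-/

namespace Summit.Ventures.CertifiedQuantumChemistry

open Matrix Finset

section Sweep

variable {R : Type*} [CommRing R]
variable {n m σ : Type*} [Fintype n] [Fintype m] [Fintype σ]

/-- Summing over configurations of `k+1` sites = summing over the last site's state and the configurations of the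
first `k` sites (`Fin.snoc`). [folklore] -/
private theorem sum_pi_fin_succ_eq_sum_snoc {M : Type*} [AddCommMonoid M] (k : ℕ) (g : (Fin (k + 1) → σ) → M) :
    ∑ S, g S = ∑ a : σ, ∑ s : Fin k → σ, g (Fin.snoc s a) := by
  rw [← (Fin.snocEquiv fun _ : Fin (k + 1) => σ).sum_comp, Fintype.sum_prod_type]
  rfl

/-- **FORMAT-qcmps0 §4's three-stage transfer step equals the one-line step.** With `M[x,s′] = L[x]·B^{s′}`,
`N[y,s] = Σ_{x,s′} O[x,y][s,s′]·M[x,s′]` and `L′[y] = Σ_s (A^s)ᵀ·N[y,s]`: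
`L′[y] = Σ_x Σ_s Σ_{s′} O[x,y][s,s′] • ((A^s)ᵀ · L[x] · B^{s′})`. -/
theorem transferStep_three_stage_eq (A B : σ → Matrix n n R) (O : σ → σ → Matrix m m R)
    (L : m → Matrix n n R) (y : m) :
    ∑ s, (A s)ᵀ * (∑ x, ∑ s', O s s' x y • (L x * B s')) =
      ∑ x, ∑ s, ∑ s', O s s' x y • ((A s)ᵀ * L x * B s') := by
  simp only [Finset.mul_sum, Matrix.mul_smul, Matrix.mul_assoc]
  rw [Finset.sum_comm]

/-- **The left-to-right sweep computes the configuration sum (FORMAT-qcmps0 §4, line 1).** Bra / ket site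
tensors `A b s, B b s : Matrix n n R`, MPO site tensors `O b s s′ : Matrix m m R` (entry `x y` = `O_b[x,y][s,s′]`),
environments `L b : m → Matrix n n R` obeying the transfer recursion
`L (b+1) y = Σ_x Σ_s Σ_{s′} (O b s s′) x y • ((A b s)ᵀ · L b x · B b s′)`. Then for every `k` and `y`,
`L k y = Σ_x Σ_{s s′ : Fin k → σ} (O_0[s₀,s′₀] ⋯ O_{k-1}[s_{k-1},s′_{k-1}]) x y •
  ((A_0^{s₀} ⋯ A_{k-1}^{s_{k-1}})ᵀ · L 0 x · (B_0^{s′₀} ⋯ B_{k-1}^{s′_{k-1}}))` (ordered products as `List.prod` of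
`List.ofFn`, site `0` leftmost). No assumption on the tensors (no gauge / canonical form, any boundary `L 0`). -/
theorem sweep_eq_sum_ofFn_prod [DecidableEq n] [DecidableEq m] (A B : ℕ → σ → Matrix n n R)
    (O : ℕ → σ → σ → Matrix m m R) (L : ℕ → m → Matrix n n R)
    (hL : ∀ b y, L (b + 1) y = ∑ x, ∑ s, ∑ s', O b s s' x y • ((A b s)ᵀ * L b x * B b s')) :
    ∀ (k : ℕ) (y : m), L k y = ∑ x, ∑ s : Fin k → σ, ∑ s' : Fin k → σ,
      (List.ofFn fun i : Fin k => O i (s i) (s' i)).prod x y •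
        ((List.ofFn fun i : Fin k => A i (s i)).prodᵀ * L 0 x * (List.ofFn fun i : Fin k => B i (s' i)).prod) := by
  intro k
  induction k with
  | zero =>
    intro y
    simp [Matrix.one_apply, ite_smul]
  | succ k ih =>
    intro y
    rw [hL k y]
    simp only [ih]
    -- push the last site's tensors and MPO entry through the sums of the first `k` sites
    simp only [Finset.mul_sum, Finset.sum_mul, Matrix.mul_smul, Matrix.smul_mul, Finset.smul_sum, smul_smul]
    -- split the configurations of `k+1` sites into (first `k` sites, last site) and the word products accordingly
    simp only [sum_pi_fin_succ_eq_sum_snoc, List.ofFn_succ', List.prod_concat, Fin.snoc_castSucc, Fin.snoc_last,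
      Fin.val_castSucc, Fin.val_last, Matrix.mul_apply, Finset.sum_smul]
    -- sort the binders of both sides by type (`m` before `σ` before `Fin k → σ`), then swap the two outer `m` sums
    simp only [Finset.sum_comm (γ := σ) (α := m), Finset.sum_comm (γ := Fin k → σ) (α := m),
      Finset.sum_comm (γ := Fin k → σ) (α := σ)]
    rw [Finset.sum_comm]
    refine Finset.sum_congr rfl fun x' _ => Finset.sum_congr rfl fun x _ => Finset.sum_congr rfl fun a _ =>
      Finset.sum_congr rfl fun a' _ => Finset.sum_congr rfl fun s _ => Finset.sum_congr rfl fun s' _ => ?_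
    congr 1
    · ring
    · simp only [Matrix.transpose_mul, Matrix.mul_assoc]

/-- `w ⬝ ((Xᵀ · u u′ᵀ · Y) w′) = (u ⬝ X w) · (u′ ⬝ Y w′)`: a transposed word, a rank-one boundary block and a word,
closed with two vectors, factor into two open-boundary amplitudes. [folklore] -/
private theorem dotProduct_transpose_mul_vecMulVec_mul_mulVec (X Y : Matrix n n R) (u u' w w' : n → R) :
    w ⬝ᵥ ((Xᵀ * vecMulVec u u' * Y) *ᵥ w') = (u ⬝ᵥ (X *ᵥ w)) * (u' ⬝ᵥ (Y *ᵥ w')) := by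
  rw [← Matrix.mulVec_mulVec, ← Matrix.mulVec_mulVec, Matrix.dotProduct_mulVec, Matrix.vecMul_transpose,
    Matrix.vecMulVec_mulVec]
  simp only [dotProduct, Pi.smul_apply, op_smul_eq_mul, Finset.sum_mul]
  exact Finset.sum_congr rfl fun i _ => by ring

/-- **Closing the sweep with boundary vectors: `⟨ψ_A| O |ψ_B⟩`.** Under the transfer recursion of
`sweep_eq_sum_ofFn_prod`, if the initial environment is the rank-one block `u u′ᵀ` on one MPO state `x₀` (and `0`
on the others), then `w ⬝ (L k y) w′ = Σ_{s,s′} (O-word s s′)[x₀,y] · ψ_A(s) · ψ_B(s′)` with the open-boundary MPS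
amplitudes `ψ_A(s) = u ⬝ (A_0^{s₀}⋯A_{k-1}^{s_{k-1}}) w` and `ψ_B(s′) = u′ ⬝ (B-word s′) w′`. In the cell's files the
end bonds are one-dimensional, so (after zero-padding) `u = w = u′ = w′ = e₀`, `x₀ = START`, `y = END`, `A = B`:
the swept number `L_k[END]` IS `Σ_{s,s′} ψ(s) O(s,s′) ψ(s′) = ⟨ψ|O|ψ⟩` for the operator `O` whose configuration
matrix elements are the MPO word products. -/
theorem dotProduct_sweep_mulVec_eq [DecidableEq n] [DecidableEq m] (A B : ℕ → σ → Matrix n n R)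
    (O : ℕ → σ → σ → Matrix m m R) (L : ℕ → m → Matrix n n R)
    (hL : ∀ b y, L (b + 1) y = ∑ x, ∑ s, ∑ s', O b s s' x y • ((A b s)ᵀ * L b x * B b s'))
    (x₀ : m) (u u' : n → R) (hL0 : ∀ x, L 0 x = if x = x₀ then vecMulVec u u' else 0)
    (k : ℕ) (y : m) (w w' : n → R) :
    w ⬝ᵥ (L k y *ᵥ w') = ∑ s : Fin k → σ, ∑ s' : Fin k → σ,
      (List.ofFn fun i : Fin k => O i (s i) (s' i)).prod x₀ y *
        ((u ⬝ᵥ ((List.ofFn fun i : Fin k => A i (s i)).prod *ᵥ w)) *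
          (u' ⬝ᵥ ((List.ofFn fun i : Fin k => B i (s' i)).prod *ᵥ w'))) := by
  rw [sweep_eq_sum_ofFn_prod A B O L hL k y]
  -- move the MPO-state sum innermost and collapse it onto `x₀`
  simp only [Finset.sum_comm (γ := m) (α := Fin k → σ)]
  simp only [hL0, mul_ite, ite_mul, Matrix.mul_zero, Matrix.zero_mul, smul_ite, smul_zero, Finset.sum_ite_eq',
    Finset.mem_univ, if_true]
  simp only [Matrix.sum_mulVec, dotProduct_sum, Matrix.smul_mulVec, dotProduct_smul, smul_eq_mul,
    dotProduct_transpose_mul_vecMulVec_mul_mulVec]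

/-- **The `⟨ψ|ψ⟩` sweep (trivial MPO).** If `G (b+1) = Σ_s (A b s)ᵀ · G b · B b s` then
`G k = Σ_{s : Fin k → σ} (A-word s)ᵀ · G 0 · (B-word s)`. -/
theorem gram_sweep_eq_sum_ofFn_prod [DecidableEq n] (A B : ℕ → σ → Matrix n n R) (G : ℕ → Matrix n n R)
    (hG : ∀ b, G (b + 1) = ∑ s, (A b s)ᵀ * G b * B b s) :
    ∀ k : ℕ, G k = ∑ s : Fin k → σ,
      (List.ofFn fun i : Fin k => A i (s i)).prodᵀ * G 0 * (List.ofFn fun i : Fin k => B i (s i)).prod := by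
  intro k
  induction k with
  | zero => simp
  | succ k ih =>
    rw [hG k, ih]
    simp only [Finset.mul_sum, Finset.sum_mul]
    simp only [sum_pi_fin_succ_eq_sum_snoc, List.ofFn_succ', List.prod_concat, Fin.snoc_castSucc, Fin.snoc_last,
      Fin.val_castSucc, Fin.val_last]
    refine Finset.sum_congr rfl fun a _ => Finset.sum_congr rfl fun s _ => ?_
    simp only [Matrix.transpose_mul, Matrix.mul_assoc]

/-- **Closing the `⟨ψ|ψ⟩` sweep: `⟨ψ_A|ψ_B⟩ = Σ_s ψ_A(s) ψ_B(s)`.** With `G 0 = u u′ᵀ`,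
`w ⬝ (G k) w′ = Σ_s (u ⬝ (A-word s) w) · (u′ ⬝ (B-word s) w′)`; for `A = B`, `u = u′`, `w = w′` this is the squared
norm `Σ_s ψ(s)²` of the open-boundary MPS (the denominator of the certificates' Rayleigh quotient). -/
theorem dotProduct_gram_sweep_mulVec_eq [DecidableEq n] (A B : ℕ → σ → Matrix n n R) (G : ℕ → Matrix n n R)
    (hG : ∀ b, G (b + 1) = ∑ s, (A b s)ᵀ * G b * B b s) (u u' : n → R) (hG0 : G 0 = vecMulVec u u')
    (k : ℕ) (w w' : n → R) :
    w ⬝ᵥ (G k *ᵥ w') = ∑ s : Fin k → σ,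
      (u ⬝ᵥ ((List.ofFn fun i : Fin k => A i (s i)).prod *ᵥ w)) *
        (u' ⬝ᵥ ((List.ofFn fun i : Fin k => B i (s i)).prod *ᵥ w')) := by
  rw [gram_sweep_eq_sum_ofFn_prod A B G hG k, hG0]
  simp only [Matrix.sum_mulVec, dotProduct_sum, dotProduct_transpose_mul_vecMulVec_mul_mulVec]

end Sweep

section Reverse

variable {R : Type*} [CommRing R]
variable {n m σ : Type*} [Fintype n] [Fintype m] [Fintype σ]

/-- `List.ofFn` read backwards: `[f (rev 0), …, f (rev (k-1))] = [f 0, …, f (k-1)].reverse`. [folklore] -/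
private theorem ofFn_comp_rev_eq_reverse {α : Type*} :
    ∀ (k : ℕ) (f : Fin k → α), (List.ofFn fun i : Fin k => f (Fin.rev i)) = (List.ofFn f).reverse
  | 0, f => by simp
  | k + 1, f => by
    have ih := ofFn_comp_rev_eq_reverse k (fun i : Fin k => f i.succ)
    rw [List.ofFn_succ', List.ofFn_succ, List.reverse_cons, List.concat_eq_append, ← ih]
    simp only [Fin.rev_castSucc, Fin.rev_last]

/-- The word of the mirrored chain (site `i` carries the transposed tensor of site `rev i = k-1-i`) is the
transpose of the original word read along the reversed configuration. [folklore] -/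
private theorem ofFn_transpose_rev_prod [DecidableEq n] {τ : Type*} (k : ℕ) (X : ℕ → τ → Matrix n n R)
    (t : Fin k → τ) :
    (List.ofFn fun i : Fin k => (X (Fin.rev i) (t i))ᵀ).prod =
      ((List.ofFn fun j : Fin k => X j (t (Fin.rev j))).prod)ᵀ := by
  rw [Matrix.transpose_list_prod, List.map_ofFn]
  have h := ofFn_comp_rev_eq_reverse k (fun j : Fin k => (X j (t (Fin.rev j)))ᵀ)
  simp only [Fin.rev_rev] at h
  simp only [Function.comp_def, ← h]

/-- Configurations reversed: `s ↦ s ∘ rev` is a bijection of `Fin k → σ` (an involution). [folklore] -/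
private theorem sum_comp_rev_eq {M : Type*} [AddCommMonoid M] (k : ℕ) (F : (Fin k → σ) → M) :
    ∑ t : Fin k → σ, F (fun j => t (Fin.rev j)) = ∑ s, F s :=
  Fintype.sum_bijective (fun t : Fin k → σ => fun j => t (Fin.rev j))
    (Function.Involutive.bijective fun t => by funext j; simp [Fin.rev_rev]) _ _ fun _ => rfl

/-- **Chain reversal (`reverse_problem`, FORMAT-qcmps0 §4: "R→L by chain reversal").** The MIRRORED problem —
sites in reverse order, site `i` carrying the transposed tensors `(A_{k-1-i}^s)ᵀ`, `(B_{k-1-i}^s)ᵀ` and the MPO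
tensor `O′_i[y,x][s,s′] = O_{k-1-i}[x,y][s′,s]`, boundary data exchanged (`x ↔ y`, left vectors ↔ right vectors) —
has the same configuration sum as the original with bra and ket exchanged:
`Σ_{t,t′} O′-word(t,t′)[y,x] ψ′_A(t) ψ′_B(t′) = Σ_{s,s′} O-word(s,s′)[x,y] ψ_B(s) ψ_A(s′)`
(`ψ′_A(t) = w ⬝ (A′-word t) u = ψ_A(t ∘ rev)`). For one state (`A = B`, `u = u′`, `w = w′`: the certificates)
this is literally the same number, so sweeping the mirrored chain left-to-right (what the code does for states whose
canonical side makes the right-to-left direction the tight one) computes `⟨ψ|O|ψ⟩` by `dotProduct_sweep_mulVec_eq`. -/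
theorem sum_rev_words_eq [DecidableEq n] [DecidableEq m] (k : ℕ) (A B : ℕ → σ → Matrix n n R)
    (O : ℕ → σ → σ → Matrix m m R) (x y : m) (u u' w w' : n → R) :
    ∑ t : Fin k → σ, ∑ t' : Fin k → σ,
      (List.ofFn fun i : Fin k => (O (Fin.rev i) (t' i) (t i))ᵀ).prod y x *
        ((w ⬝ᵥ ((List.ofFn fun i : Fin k => (A (Fin.rev i) (t i))ᵀ).prod *ᵥ u)) *
          (w' ⬝ᵥ ((List.ofFn fun i : Fin k => (B (Fin.rev i) (t' i))ᵀ).prod *ᵥ u'))) =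
    ∑ s : Fin k → σ, ∑ s' : Fin k → σ,
      (List.ofFn fun i : Fin k => O i (s i) (s' i)).prod x y *
        ((u' ⬝ᵥ ((List.ofFn fun i : Fin k => B i (s i)).prod *ᵥ w')) *
          (u ⬝ᵥ ((List.ofFn fun i : Fin k => A i (s' i)).prod *ᵥ w))) := by
  -- the mirrored words are transposes of the original words along the reversed configurations
  have hO : ∀ t t' : Fin k → σ, (List.ofFn fun i : Fin k => (O (Fin.rev i) (t' i) (t i))ᵀ).prod y x =
      (List.ofFn fun j : Fin k => O j (t' (Fin.rev j)) (t (Fin.rev j))).prod x y := by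
    intro t t'
    have h := ofFn_transpose_rev_prod (τ := σ × σ) k (fun j p => O j p.1 p.2) (fun i => (t' i, t i))
    simp only at h
    rw [h, Matrix.transpose_apply]
  have hV : ∀ (X : ℕ → σ → Matrix n n R) (t : Fin k → σ) (p q : n → R),
      p ⬝ᵥ ((List.ofFn fun i : Fin k => (X (Fin.rev i) (t i))ᵀ).prod *ᵥ q) =
        q ⬝ᵥ ((List.ofFn fun j : Fin k => X j (t (Fin.rev j))).prod *ᵥ p) := by
    intro X t p q
    rw [ofFn_transpose_rev_prod, Matrix.dotProduct_mulVec, Matrix.vecMul_transpose, dotProduct_comm]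
  simp only [hO, hV]
  -- reindex both configuration sums by `∘ rev` and exchange them
  rw [← sum_comp_rev_eq k (fun s => ∑ s' : Fin k → σ, (List.ofFn fun i : Fin k => O i (s i) (s' i)).prod x y *
        ((u' ⬝ᵥ ((List.ofFn fun i : Fin k => B i (s i)).prod *ᵥ w')) *
          (u ⬝ᵥ ((List.ofFn fun i : Fin k => A i (s' i)).prod *ᵥ w))))]
  rw [Finset.sum_comm]
  refine Finset.sum_congr rfl fun t _ => ?_
  rw [← sum_comp_rev_eq k]
  exact Finset.sum_congr rfl fun t' _ => by simp only [Fin.rev_rev]; ring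

end Reverse

section ValueRule

/-- **The value rule of a `qc-upper-v0` certificate (FORMAT-qcu0 §3 / FORMAT-qcmps0 §4 "BOUND").** From a lineage's
enclosures `h ≤ hhi` of `⟨ψ|H|ψ⟩` and `0 < nlo ≤ n ≤ nhi` of `⟨ψ|ψ⟩`, the printed rule
`sup := hhi / nlo if 0 ≤ hhi else hhi / nhi` gives `h ≤ E · n` for every `E ≥ sup` (so the issued dyadic
`E_U = ⌈2^e · max_ℓ sup_ℓ⌉ / 2^e` satisfies `⟨ψ|Hψ⟩ ≤ E_U ⟨ψ|ψ⟩`, the inequality of the typer's `UpperCertificate`, from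
EACH lineage alone). Any linearly ordered field (`ℚ` for the exact endpoints, `ℝ` for the claim nodes). -/
theorem le_mul_of_enclosure {K : Type*} [Field K] [LinearOrder K] [IsStrictOrderedRing K]
    {h hhi n nlo nhi E : K} (hh : h ≤ hhi) (hlo : nlo ≤ n) (hhi' : n ≤ nhi) (hpos : 0 < nlo)
    (hE : (if 0 ≤ hhi then hhi / nlo else hhi / nhi) ≤ E) : h ≤ E * n := by
  have hn : 0 < n := hpos.trans_le hlo
  split_ifs at hE with hsgn
  · calc h ≤ hhi := hh
      _ = hhi / nlo * nlo := by field_simp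
      _ ≤ hhi / nlo * n := by gcongr
      _ ≤ E * n := by gcongr
  · have hnhi : 0 < nhi := hn.trans_le hhi'
    have hq : hhi / nhi ≤ 0 := div_nonpos_of_nonpos_of_nonneg (le_of_lt (lt_of_not_ge hsgn)) hnhi.le
    calc h ≤ hhi := hh
      _ = hhi / nhi * nhi := by field_simp
      _ ≤ hhi / nhi * n := mul_le_mul_of_nonpos_left hhi' hq
      _ ≤ E * n := by gcongr

/-- Branch-free form of the value rule: `h ≤ max (hhi / nlo) (hhi / nhi) · n` under the same enclosures (the printed
rule selects the branch that attains the `max`). -/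
theorem le_max_div_mul_of_enclosure {K : Type*} [Field K] [LinearOrder K] [IsStrictOrderedRing K]
    {h hhi n nlo nhi : K} (hh : h ≤ hhi) (hlo : nlo ≤ n) (hhi' : n ≤ nhi) (hpos : 0 < nlo) :
    h ≤ max (hhi / nlo) (hhi / nhi) * n := by
  refine le_mul_of_enclosure hh hlo hhi' hpos ?_
  split_ifs
  · exact le_max_left _ _
  · exact le_max_right _ _

end ValueRule


end Summit.Ventures.CertifiedQuantumChemistry
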